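import Summits.QuantumFields.BalabanUV.T4Continuum.Support.NE4TwoRunStepModel
import Summits.QuantumFields.BalabanUV.T4Continuum.Support.NE4TwoRunChannelsWeighted

/-!
# NE4TwoRunStepModelEnd — binder row NE4 (spine node U2), technique P2 «two-trajectory comparison at spacings ε vs ε/L»:
# CLOSURE of the two-history budget of `NE4TwoRunStepModel` and node U2's spine output FROM ROW NE5's STEP MODEL AT TWO
# COUPLING HISTORIES, BY TYPE (companion of `NE4TwoRunStepModel`; skeleton `HOME/t4/skeletons/NE4-t4-ne4-p2.md` §5b; cell
# `pub-balaban`, `HOME/BINDER-OWNERS.md` row NE4, co-owner seat t4-ne4-p2, gen 19).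

HONEST FRAMING (T4-DAG PAGE 1).  Rung (B)+1 on a FIXED finite torus T⁴ — NOT infinite volume, NOT a mass gap, NOT the Clay
problem.  NE4 is NOT PRINTED in [Balaban1987RG1]–[Balaban1989LargeFieldII] and NOT PROVED here; nothing about Bałaban's
effective actions is asserted: the inputs are row NE5's HYPOTHESIS SHAPES over `T4InputCauchyRateData.StepModel` BY NAME
(`RepresentsA/B`, `InBase`, `DataLipschitz` = GAPS G-ne5p1-1′/1″, `DecayBound`, `OperatorRate` = MI-1 ⇐ rows NE2/NE3,
`InsertionRate`, `InsertionDamped` = MI-3a), this route's two last-coupling data shapes `CouplingDataOp`/`CouplingDataIns`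
(row-NE9 type) and β read-out binder `TwoRunReadOutModel` (R), (AF-0r) as the binder `hconv` (β sub-cell, member of
`FlowStep.BetaPertH`, NOT discharged), the infrared-pinned runs in the box as binders `hrun`/`hbox`/`hpin` (node U1/H3; (B)/(B^μ)
live there).  Every theorem is real bookkeeping (one primitive recursion, one strong induction, geometric identities).
HONEST DEPENDENCY (cell, verbatim): continuum YM on T⁴ ⇐ BetaPertH ∧ nine spine estimates (0/9 proved); BetaPertH ⇐ (D1) ∧
(D4) ∧ CAP+tail; G-an2-4 gates asym, D1 and NE2/3/4.  VALUE = kernel bookkeeping; NOT summit progress.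

CONTENT.  §3 the CLOSURE of the two-history budget `NE4TwoRunStepModel.RecursiveRate₂ EA EB gA gB κ θ ω A ℓ b`: the explicit
majorant sequence `cl` (memory state `mem`, primitive recursion; `cl k = Aθ^k + ℓ·|gA (k−1) − gB (k−1)| + Σ_{j<k} bω^{k−j}·cl j`,
`cl_eq`), nonnegativity, and `boundedAtScale₂_cl` (every scale slice of the pair is majorised by `cl`); then the IDENTIFICATION
with the channel shapes of `NE4TwoRunChannelsWeighted`/`NE4TwoRunChannels`: `b j := cl (j+1)` satisfies `BirthChannelsW K ℓ (bω)
ω` with sources `σ j = Aθ^{j+1}`, unpartnered slot `u j = ω^j·cl 0`, transported discrepancies `e i n = cl (i+1)` — with EQUALITY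
(the age weight ω^{j−1−i} of the birth channel IS row NE5's printed age factor, [Balaban1988RG2Cluster] (1.24) p. 7 / p. 8) —,
`TransportLaw K 1 e 0` (transport at rate one, no source: in model currency an old term IS a function of the background, its
re-evaluation on the next level is evaluation — skeleton leaf L11) and `BirthProjection K 1 b 0 e` (leaf L12).  §4
**`injectedRate_of_stepModel₂`**: node U2's spine binder `T4CauchySum.InjectedRate D 0 ρ (fun K j ↦ T4CouplingMatching.disc (g K)
(g (K+1)) j)` LITERALLY (the `hinj` of `T4TowerRateDischarge.uRateUpTo_of_nodes`, `Cd := D`, `θc := ρ`), from the StepModel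
shapes at the pairs of histories `(g K, fun i ↦ g (K+1) (i+1))`, the two coupling-data shapes, the read-out binder, (AF-0r),
runs/box/pin, a coordinatewise diameter `Γ` of the window, and the SCALARS: the near hypothesis and first scales of
`recursiveRate₂_of_stepModel_lip`, `θ ≤ ρ < 1`, the MEMORY GAP `ω·(1 + Λc) < ρ` (age factor × (1 + the step's history modulus)
below the rate — compare row NE5's own smallness `ω + Λc < θ′` in `ne5_at_of_stepModel_lip_nat`), and the γ-window of
`T4TwoRunMatching.disc_le_of_twoRun`.  Composition: `recursiveRate₂_of_stepModel_lip` ⇒ §3 ⇒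
`NE4TwoRunChannelsWeighted.injectedRate_of_channelsW` (age weight `ϖ := ω`, transport rate 1, `ν := 0`, `μ := Λcω`, `p₀ := 1`,
`a₁ := A`, `aU := A + ℓΓ`, `aZ = aτ = 0`).  Constant displayed in the statement.  §5 (v1.1, ADDITIVE; §§3–4 byte-identical to v1 p208147): the same END in row NE5's two
other currencies — `injectedRate_of_stepModel₂_nat` (`InsertionDampedNat`, natural history gain, MEMORY GAP `ω + Λc < ρ` = NE5's
own smallness letters) and `injectedRate_of_stepModel₂_fibre` (every wall primitive: fibre envelopes `OpFibreEnvelope`∕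
`HistFibreEnvelope`, `InsAffine ∧ InsBlind ∧ InsHomog ∧ InsScaleBound`, Λ = G∕(1 − ρ₀)).  Module of unit `b2b-balaban-t4-ne4-p2` (gen
19); imports `NE4TwoRunStepModel` and `NE4TwoRunChannelsWeighted` (this lineage, Summits) and modifies nothing; no `sorry`, no `axiom`.
-/

namespace Summit.QuantumFields.BalabanUV.T4Continuum.NE4TwoRunStepModelEnd

open Literature.MathematicalPhysics.QuantumFieldTheory.Balaban1983to89
open T4OutputRate (Carriers Functional DecayBound)
open T4InputCauchyRateData (StepModel)
open FlowStep (HBeta RGEqH)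
open T4TwoRunMatching (TwoRunReadOut remMismatch)
open NE4TwoRunChannels (TransportLaw BirthProjection)
open NE4TwoRunChannelsWeighted (BirthChannelsW injectedRate_of_channelsW)
open NE4TwoRunStepModel
open Metric Set Finset

/-! ## §3 Closure of the two-history budget: the explicit majorant and its identification with the channel shapes -/

section Closure

variable {C : Carriers}

/-- The MEMORY STATE of the closure: `mem k = Σ_{j<k} ω^{k−j}·cl j` computed by primitive recursion together with the
majorant `cl k = Aθ^k + ℓ·|gA (k−1) − gB (k−1)| + b·mem k` (`mem_eq_sum`, `cl_eq`). [folklore] -/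
noncomputable def mem (A ℓ b θ ω : ℝ) (gA gB : ℕ → ℝ) : ℕ → ℝ
  | 0 => 0
  | k + 1 => ω * (mem A ℓ b θ ω gA gB k + (A * θ ^ k + ℓ * |gA (k - 1) - gB (k - 1)| + b * mem A ℓ b θ ω gA gB k))

/-- THE EXPLICIT MAJORANT SEQUENCE of the pair of runs: `cl k = Aθ^k + ℓ·|gA (k−1) − gB (k−1)| + Σ_{j<k} bω^{k−j}·cl j`
(`cl_eq`) — the least solution of the two-history budget read with equality. [folklore] -/
noncomputable def cl (A ℓ b θ ω : ℝ) (gA gB : ℕ → ℝ) (k : ℕ) : ℝ :=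
  A * θ ^ k + ℓ * |gA (k - 1) - gB (k - 1)| + b * mem A ℓ b θ ω gA gB k

/-- The memory state is the age-weighted sum of the earlier majorants. [folklore] -/
theorem mem_eq_sum (A ℓ b θ ω : ℝ) (gA gB : ℕ → ℝ) (k : ℕ) :
    mem A ℓ b θ ω gA gB k = ∑ j ∈ range k, ω ^ (k - j) * cl A ℓ b θ ω gA gB j := by
  induction k with
  | zero => simp [mem]
  | succ k ih =>
    rw [sum_range_succ, Nat.add_sub_cancel_left, pow_one]
    have h : ∑ j ∈ range k, ω ^ (k + 1 - j) * cl A ℓ b θ ω gA gB j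
        = ω * ∑ j ∈ range k, ω ^ (k - j) * cl A ℓ b θ ω gA gB j := by
      rw [mul_sum]
      refine sum_congr rfl fun j hj => ?_
      rw [show k + 1 - j = (k - j) + 1 by have := mem_range.1 hj; omega, pow_succ]
      ring
    rw [h, ← ih]
    simp only [mem, cl]
    ring

/-- The defining identity of the majorant: the two-history budget with EQUALITY. [folklore] -/
theorem cl_eq (A ℓ b θ ω : ℝ) (gA gB : ℕ → ℝ) (k : ℕ) :
    cl A ℓ b θ ω gA gB k
      = A * θ ^ k + ℓ * |gA (k - 1) - gB (k - 1)| + ∑ j ∈ range k, b * ω ^ (k - j) * cl A ℓ b θ ω gA gB j := by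
  have e : cl A ℓ b θ ω gA gB k = A * θ ^ k + ℓ * |gA (k - 1) - gB (k - 1)| + b * mem A ℓ b θ ω gA gB k := rfl
  rw [e, mem_eq_sum, mul_sum]
  congr 1
  exact sum_congr rfl fun j _ => by ring

/-- The majorant is nonnegative for nonnegative constants. [folklore] -/
theorem cl_nonneg {A ℓ b θ ω : ℝ} (hA : 0 ≤ A) (hℓ : 0 ≤ ℓ) (hb : 0 ≤ b) (hθ : 0 ≤ θ) (hω : 0 ≤ ω)
    (gA gB : ℕ → ℝ) : ∀ k, 0 ≤ cl A ℓ b θ ω gA gB k := by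
  intro k
  induction k using Nat.strong_induction_on with
  | _ k ih =>
    rw [cl_eq]
    refine add_nonneg (add_nonneg (mul_nonneg hA (pow_nonneg hθ k)) (mul_nonneg hℓ (abs_nonneg _))) ?_
    exact sum_nonneg fun j hj => mul_nonneg (mul_nonneg hb (pow_nonneg hω _)) (ih j (mem_range.1 hj))

/-- **CLOSURE.**  Under the two-history budget `RecursiveRate₂ EA EB gA gB κ θ ω A ℓ b` (nonnegative constants) EVERY scale
slice of the pair is majorised by the explicit sequence: `BoundedAtScale₂ EA EB gA gB κ k (cl k)` — strong induction on the
creation scale. [folklore] -/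
theorem boundedAtScale₂_cl {EA : Functional C C.BgA} {EB : Functional C C.BgB} {gA gB : ℕ → ℝ} {κ θ ω A ℓ b : ℝ}
    (hA : 0 ≤ A) (hℓ : 0 ≤ ℓ) (hb : 0 ≤ b) (hθ : 0 ≤ θ) (hω : 0 ≤ ω)
    (h : RecursiveRate₂ EA EB gA gB κ θ ω A ℓ b) : ∀ k, BoundedAtScale₂ EA EB gA gB κ k (cl A ℓ b θ ω gA gB k) := by
  intro k
  induction k using Nat.strong_induction_on with
  | _ k ih =>
    have hk := h k (cl A ℓ b θ ω gA gB) fun j hj => ⟨cl_nonneg hA hℓ hb hθ hω gA gB j, ih j hj⟩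
    rw [cl_eq]
    exact hk

/-- THE IDENTIFICATION WITH THE AGE-WEIGHTED BIRTH CHANNELS (skeleton leaves L7/L8/L9a in model currency): for the pair of runs
(A at `gA`, B at `gB`, partnered data read at `gA` and `fun i ↦ gB (i+1)`) the pair-`j` birth majorant `b j := cl (j+1)`
satisfies `NE4TwoRunChannelsWeighted.BirthChannelsW K ℓ (bω) ω gA gB b σ u e` with sources `σ j = Aθ^{j+1}`, unpartnered
slot `u j = ω^j·cl 0` (the scale-0 slice, created before the first partnered step), transported discrepancies `e i n = cl
(i+1)` — with EQUALITY: the age weight `ω^{j−1−i}` of the birth channel IS row NE5's printed age factor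
([Balaban1988RG2Cluster] (1.24) p. 7 / p. 8), and the coupling slot reads `|gA j − gB (j+1)|` = the explicit couplings of the
partnered steps A-(j+1), B-(j+2) ((0.20), (1.7)). [folklore] -/
theorem birthChannelsW_cl (A ℓ b θ ω : ℝ) (gA gB : ℕ → ℝ) (K : ℕ) :
    BirthChannelsW K ℓ (b * ω) ω gA gB (fun j => cl A ℓ b θ ω gA (fun i => gB (i + 1)) (j + 1))
      (fun j => A * θ ^ (j + 1)) (fun j => ω ^ j * cl A ℓ b θ ω gA (fun i => gB (i + 1)) 0)
      (fun i _ => cl A ℓ b θ ω gA (fun i => gB (i + 1)) (i + 1)) := by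
  intro j _
  dsimp only
  have e := cl_eq A ℓ b θ ω gA (fun i => gB (i + 1)) (j + 1)
  rw [sum_range_succ'] at e
  simp only [Nat.add_sub_cancel, Nat.sub_zero] at e
  have hs : ∑ i ∈ range j, b * ω ^ (j + 1 - (i + 1)) * cl A ℓ b θ ω gA (fun i => gB (i + 1)) (i + 1)
      = b * ω * ∑ i ∈ range j, ω ^ (j - 1 - i) * cl A ℓ b θ ω gA (fun i => gB (i + 1)) (i + 1) := by
    rw [mul_sum]
    refine sum_congr rfl fun i hi => ?_
    have hij := mem_range.1 hi
    rw [show j + 1 - (i + 1) = (j - 1 - i) + 1 by omega, pow_succ]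
    ring
  rw [hs] at e
  rw [e, pow_succ ω j]
  apply le_of_eq
  ring

/-- TRANSPORT AT RATE ONE, NO SOURCE (skeleton leaf L11 in model currency): with `e i n = cl (i+1)` independent of the age
`n` — an old term IS a function of the background; re-evaluation on the next level is evaluation —
`NE4TwoRunChannels.TransportLaw K 1 e 0` holds trivially. [folklore] -/
theorem transportLaw_cl (A ℓ b θ ω : ℝ) (gA gB : ℕ → ℝ) (K : ℕ) :
    TransportLaw K 1 (fun i _ => cl A ℓ b θ ω gA gB (i + 1)) (fun _ _ => 0) := by
  intro i n _
  simp

/-- BIRTH PROJECTION WITH `p₀ = 1`, `z = 0` (skeleton leaf L12 in model currency: the table entry IS the propagating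
object of the model). [folklore] -/
theorem birthProjection_cl (A ℓ b θ ω : ℝ) (gA gB : ℕ → ℝ) (K : ℕ) :
    BirthProjection K 1 (fun j => cl A ℓ b θ ω gA gB (j + 1)) (fun _ => 0)
      (fun i _ => cl A ℓ b θ ω gA gB (i + 1)) := by
  intro i _
  simp

/-- The unpartnered slot is geometric: `ω^j·cl 0 ≤ (A + ℓΓ)·ρ^j` when `ω ≤ ρ` and the two histories are coordinatewise
`Γ`-close (`cl 0 = A + ℓ·|gA 0 − gB 0|`, the over-generous `k = 0` clause of the budget). [folklore] -/
theorem unpartnered_le {A ℓ b θ ω ρ Γ : ℝ} {gA gB : ℕ → ℝ} (hA : 0 ≤ A) (hℓ : 0 ≤ ℓ) (hω : 0 ≤ ω) (hωρ : ω ≤ ρ)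
    (hΓ : ∀ i, |gA i - gB i| ≤ Γ) (j : ℕ) : ω ^ j * cl A ℓ b θ ω gA gB 0 ≤ (A + ℓ * Γ) * ρ ^ j := by
  have h0 : cl A ℓ b θ ω gA gB 0 = A + ℓ * |gA 0 - gB 0| := by simp [cl, mem]
  have h1 : cl A ℓ b θ ω gA gB 0 ≤ A + ℓ * Γ := by
    rw [h0]; exact add_le_add le_rfl (mul_le_mul_of_nonneg_left (hΓ 0) hℓ)
  have h2 : 0 ≤ cl A ℓ b θ ω gA gB 0 := by rw [h0]; exact add_nonneg hA (mul_nonneg hℓ (abs_nonneg _))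
  calc ω ^ j * cl A ℓ b θ ω gA gB 0 ≤ ρ ^ j * (A + ℓ * Γ) :=
        mul_le_mul (pow_le_pow_left₀ hω hωρ j) h1 h2 (pow_nonneg (hω.trans hωρ) j)
    _ = (A + ℓ * Γ) * ρ ^ j := mul_comm _ _

end Closure

/-! ## §4 Node U2's spine output from row NE5's model at two histories, BY TYPE -/

section End

variable {C : Carriers} {Op Hist : Type*} [NormedAddCommGroup Op] [NormedSpace ℂ Op] [NormedAddCommGroup Hist]
  [NormedSpace ℂ Hist]

/-- **NODE U2's SPINE OUTPUT FROM ROW NE5's STEP MODEL AT TWO COUPLING HISTORIES, K-UNIFORM (skeleton §5b as a theorem).**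
For the family of infrared-pinned runs `g K` of (0.20) in the box ]0, γ] (node U1/H3 — binders `hrun`/`hbox`/`hpin`), the
histories `g K` and `fun i ↦ g (K+1) (i+1)` in a window `W` of coordinatewise diameter `Γ`; ONE step model `M` with row NE5's
shapes BY NAME (`RepresentsA/B`, `InBase`, `DataLipschitz κ Λ ρ₀`, `DecayBound`, `OperatorRate δ θ`, `InsertionRate κ E₀ δ′ θ`,
`InsertionDamped κ c ω`) on `W`; the two coupling-data shapes `CouplingDataOp ℓop`, `CouplingDataIns κ E₀ ℓins` (§1); the β
read-out binder `TwoRunReadOutModel S r` for every consecutive pair; (AF-0r) (binder `hconv`, β sub-cell); and the SCALARS: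
the near hypothesis and first scales of §2, `θ ≤ ρ < 1`, the MEMORY GAP `ω·(1 + Λc) < ρ` (age factor × (1 + the step's
history modulus) below the rate), and the γ-window `r·(Λ(ℓop + ℓins)γ³)·(ρ − ω)/(ρ − ω(1 + Λc)) ≤ (1 − ρ)/2` of
`T4TwoRunMatching.disc_le_of_twoRun`.  THEN `T4CauchySum.InjectedRate D 0 ρ (fun K j ↦ T4CouplingMatching.disc (g K) (g (K+1))
j)` — LITERALLY the binder `hinj` of the spine's `T4TowerRateDischarge.uRateUpTo_of_nodes` (`Cd := D`, `θc := ρ`) — with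
`D = 2(2c₀ + r·(A + Λcω(A + Λ(ℓop + ℓins)Γ))·(ρ − ω)/(ρ − ω(1 + Λc)))/(1 − ρ)`, `A = Λ(δ + δ′) + B`.  Composition: §2 ⇒ §3
(`cl`, channel identities) ⇒ `NE4TwoRunChannelsWeighted.injectedRate_of_channelsW` (age weight `ϖ := ω`, transport rate 1,
`ν := 0`, `μ := Λcω`, `p₀ := 1`).  Bookkeeping over UNPRINTED inputs; NOT summit progress. [folklore] -/
theorem injectedRate_of_stepModel₂ {β : HBeta} (S : B12Beta.OneLoopSplit β) (g : ℕ → ℕ → ℝ) (gIR : ℝ)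
    (M : StepModel C Op Hist) {EA : Functional C C.BgA} {EB : Functional C C.BgB} {W : Set (ℕ → ℝ)}
    {κ Λ EA₀ E₀ δ δ' θ c ω ρ₀ B ℓop ℓins Γ γ binf c₀ r ρ : ℝ} {k₀ : ℕ}
    -- row NE5's shapes BY NAME
    (hrA : M.RepresentsA EA W) (hrB : M.RepresentsB EB W) (hbase : M.InBase EB W) (hlip : M.DataLipschitz W κ Λ ρ₀)
    (hdA : DecayBound EA W EA₀ κ) (hdB : DecayBound EB W E₀ κ) (hop : M.OperatorRate W δ θ)
    (hins : M.InsertionRate W κ E₀ δ' θ) (hdamp : M.InsertionDamped W κ c ω)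
    -- this route's one-step additions (row-NE9 type) and the read-out binder (R)
    (hcop : CouplingDataOp M W ℓop) (hcins : CouplingDataIns M W κ E₀ ℓins)
    (hread : ∀ K, TwoRunReadOutModel S r EA EB κ (g K) (g (K + 1)) K)
    -- the runs (node U1/H3) and the window
    (hrun : ∀ K, RGEqH K β (g K)) (hbox : ∀ K i, i ≤ K → 0 < g K i ∧ g K i ≤ γ) (hpin : ∀ K, g K K = gIR)
    (hgA : ∀ K, g K ∈ W) (hgB : ∀ K, (fun i => g (K + 1) (i + 1)) ∈ W)
    (hWΓ : ∀ g₁ ∈ W, ∀ g₂ ∈ W, ∀ i, |g₁ i - g₂ i| ≤ Γ)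
    -- (AF-0r), β sub-cell
    (hconv : ∀ k, |S.β0 k - binf| ≤ c₀ * ρ ^ k)
    -- scalars
    (hΛ : 0 ≤ Λ) (hδ : 0 ≤ δ + δ') (hθ : 0 ≤ θ) (hθρ : θ ≤ ρ) (hρ1 : ρ < 1) (hc : 0 ≤ c) (hω0 : 0 < ω)
    (hℓop : 0 ≤ ℓop) (hℓins : 0 ≤ ℓins) (hB : 0 ≤ B) (hc₀ : 0 ≤ c₀) (hr : 0 ≤ r)
    (hnear : (δ + δ') * θ ^ k₀ + c * (EA₀ + E₀) * (ω / (1 - ω)) + (ℓop + ℓins) * Γ ≤ ρ₀)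
    (hfirst : ∀ k < k₀, EA₀ + E₀ ≤ B * θ ^ k)
    (hgap : ω * (1 + Λ * c) < ρ)
    (hgain : r * (Λ * (ℓop + ℓins) * γ ^ 3) * ((ρ - ω) / (ρ - ω * (1 + Λ * c))) ≤ (1 - ρ) / 2) :
    T4CauchySum.InjectedRate
      (2 * (2 * c₀ + r * ((Λ * (δ + δ') + B) + Λ * c * ω * ((Λ * (δ + δ') + B) + Λ * (ℓop + ℓins) * Γ))
        * ((ρ - ω) / (ρ - ω * (1 + Λ * c)))) / (1 - ρ)) 0 ρ
      (fun K j => T4CouplingMatching.disc (g K) (g (K + 1)) j) := by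
  -- names for the constants of the two-history budget
  set A := Λ * (δ + δ') + B with hA_def
  set ℓ := Λ * (ℓop + ℓins) with hℓ_def
  set bH := Λ * c with hbH_def
  have hA : 0 ≤ A := add_nonneg (mul_nonneg hΛ hδ) hB
  have hℓ : 0 ≤ ℓ := mul_nonneg hΛ (add_nonneg hℓop hℓins)
  have hb : 0 ≤ bH := mul_nonneg hΛ hc
  have hω : 0 ≤ ω := hω0.le
  have hωne : ω ≠ 0 := hω0.ne'
  have hωρ : ω < ρ := by nlinarith [mul_nonneg hω hb]
  have hω1 : ω < 1 := hωρ.trans hρ1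
  have hθ1 : θ ≤ 1 := hθρ.trans hρ1.le
  -- the pairs of histories and their coordinatewise closeness
  have hΓ : ∀ K i, |g K i - g (K + 1) (i + 1)| ≤ Γ := fun K i => hWΓ _ (hgA K) _ (hgB K) i
  have hΓ0 : 0 ≤ Γ := (abs_nonneg _).trans (hΓ 0 0)
  -- §2 at every pair, then §3
  have hrec : ∀ K, RecursiveRate₂ EA EB (g K) (fun i => g (K + 1) (i + 1)) κ θ ω A ℓ bH := fun K =>
    recursiveRate₂_of_stepModel_lip M (hgA K) (hgB K) hrA hrB hbase hlip hdA hdB hop hins hdamp hcop hcins (hΓ K)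
      hΛ hδ hθ hθ1 hc hω hω1 (add_nonneg hℓop hℓins) hnear hB hfirst
  have hcl : ∀ K k, BoundedAtScale₂ EA EB (g K) (fun i => g (K + 1) (i + 1)) κ k
      (cl A ℓ bH θ ω (g K) (fun i => g (K + 1) (i + 1)) k) := fun K =>
    boundedAtScale₂_cl hA hℓ hb hθ hω (hrec K)
  have hcl0 : ∀ K k, 0 ≤ cl A ℓ bH θ ω (g K) (fun i => g (K + 1) (i + 1)) k := fun K =>
    cl_nonneg hA hℓ hb hθ hω _ _
  -- the binders of `injectedRate_of_channelsW`
  have hread' : ∀ K, TwoRunReadOut S r (g K) (g (K + 1))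
      (fun j => cl A ℓ bH θ ω (g K) (fun i => g (K + 1) (i + 1)) (j + 1)) K :=
    fun K j hj => hread K j hj _ (hcl0 K (j + 1)) (hcl K (j + 1))
  have e1 : (1 + bH * ω * 1 / (ω * 1)) * (ω * 1) = ω * (1 + bH) := by
    simp only [mul_one]
    rw [mul_div_assoc, div_self hωne, mul_one, mul_comm]
  have hgap' : ω * 1 + bH * ω * 1 < ρ := by
    have e2 : ω * 1 + bH * ω * 1 = ω * (1 + bH) := by ring
    rw [e2]
    exact hgap
  have h01 : (0 : ℝ) < ω * 1 := by rw [mul_one]; exact hω0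
  have h11 : ω * 1 ≤ 1 := by rw [mul_one]; exact hω1.le
  have hσ : ∀ (K j : ℕ), A * θ ^ (j + 1) ≤ A * ρ ^ j := by
    intro _ j
    have : θ ^ (j + 1) ≤ ρ ^ j :=
      calc θ ^ (j + 1) = θ ^ j * θ := pow_succ θ j
        _ ≤ θ ^ j * 1 := mul_le_mul_of_nonneg_left hθ1 (pow_nonneg hθ j)
        _ = θ ^ j := mul_one _
        _ ≤ ρ ^ j := pow_le_pow_left₀ hθ hθρ j
    exact mul_le_mul_of_nonneg_left this hA
  have hu : ∀ (K j : ℕ), ω ^ j * cl A ℓ bH θ ω (g K) (fun i => g (K + 1) (i + 1)) 0 ≤ (A + ℓ * Γ) * ρ ^ j :=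
    fun K j => unpartnered_le hA hℓ hω hωρ.le (hΓ K) j
  have hz : ∀ (K i : ℕ), (0 : ℝ) ≤ 0 * ρ ^ i := fun _ _ => by simp
  have hτ : ∀ (K i n : ℕ), (0 : ℝ) ≤ 0 * ρ ^ i * (0 : ℝ) ^ n := fun _ _ _ => by simp
  have hgain' : r * (ℓ * γ ^ 3) * ((ρ - ω * 1) / (ρ - (1 + bH * ω * 1 / (ω * 1)) * (ω * 1))) ≤ (1 - ρ) / 2 := by
    rw [e1, mul_one]
    exact hgain
  have key := injectedRate_of_channelsW S g gIR
    (b := fun K j => cl A ℓ bH θ ω (g K) (fun i => g (K + 1) (i + 1)) (j + 1))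
    (σ := fun _ j => A * θ ^ (j + 1)) (u := fun K j => ω ^ j * cl A ℓ bH θ ω (g K) (fun i => g (K + 1) (i + 1)) 0)
    (z := fun _ _ => 0) (e := fun K i _ => cl A ℓ bH θ ω (g K) (fun i => g (K + 1) (i + 1)) (i + 1))
    (τ := fun _ _ _ => 0)
    (ϖ := ω) (ω := 1) (ν := 0) (μ := bH * ω) (p₀ := 1) (a₁ := A) (aU := A + ℓ * Γ) (aZ := 0) (aτ := 0)
    hρ1 hω zero_le_one h01 h11 le_rfl zero_lt_one hgap' hc₀ hr hℓ (mul_nonneg hb hω) zero_le_one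
    hA (add_nonneg hA (mul_nonneg hℓ hΓ0)) le_rfl le_rfl
    hrun hbox hpin hconv hread' (fun K i _ => hcl0 K (i + 1))
    (fun K => birthChannelsW_cl A ℓ bH θ ω (g K) (g (K + 1)) K)
    (fun K => birthProjection_cl A ℓ bH θ ω (g K) (fun i => g (K + 1) (i + 1)) K)
    (fun K => transportLaw_cl A ℓ bH θ ω (g K) (fun i => g (K + 1) (i + 1)) K)
    hσ hu hz hτ hgain'
  have e : 2 * (2 * c₀ + r * (A + bH * ω * (A + ℓ * Γ) + bH * ω * (0 + 0 / (1 - 0)) / (ρ - ω * 1))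
      * ((ρ - ω * 1) / (ρ - (1 + bH * ω * 1 / (ω * 1)) * (ω * 1)))) / (1 - ρ)
      = 2 * (2 * c₀ + r * (A + bH * ω * (A + ℓ * Γ)) * ((ρ - ω) / (ρ - ω * (1 + bH)))) / (1 - ρ) := by
    rw [e1]
    simp
  rw [e] at key
  exact key

end End

/-! ## §5 (v1.1, ADDITIVE) The END in row NE5's two other currencies: natural history gain, and every wall primitive -/

section Currencies

variable {C : Carriers} {Op Hist : Type*} [NormedAddCommGroup Op] [NormedSpace ℂ Op] [NormedAddCommGroup Hist]
  [NormedSpace ℂ Hist]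

/-- **THE END WITH THE PRINTED AGE NORMALISATION** (row NE5's `InsertionDampedNat W κ c ω`: the newest previous scale
undamped, natural history gain `c` — the letters of NE5's `ne5_at_of_stepModel_lip_nat`).  As `injectedRate_of_stepModel₂`
with `InsertionDamped` replaced by `InsertionDampedNat` (converted by NE5's `insertionDamped_of_nat`, model gain `c/ω`):
near hypothesis `(δ + δ′)θ^{k₀} + c(EA₀ + E₀)/(1 − ω) + (ℓop + ℓins)Γ ≤ ρ₀`, MEMORY GAP `ω + Λc < ρ` (age factor PLUS the
step's natural history modulus — literally NE5's own smallness `ω + Λc < θ′` with `θ′ := ρ`), γ-window with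
`(ρ − ω)/(ρ − (ω + Λc))`; constant `2(2c₀ + r(A + Λc(A + Λ(ℓop + ℓins)Γ))(ρ − ω)/(ρ − (ω + Λc)))/(1 − ρ)`,
`A = Λ(δ + δ′) + B`.  Bookkeeping over UNPRINTED inputs; NOT summit progress. [folklore] -/
theorem injectedRate_of_stepModel₂_nat {β : HBeta} (S : B12Beta.OneLoopSplit β) (g : ℕ → ℕ → ℝ) (gIR : ℝ)
    (M : StepModel C Op Hist) {EA : Functional C C.BgA} {EB : Functional C C.BgB} {W : Set (ℕ → ℝ)}
    {κ Λ EA₀ E₀ δ δ' θ c ω ρ₀ B ℓop ℓins Γ γ binf c₀ r ρ : ℝ} {k₀ : ℕ}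
    (hrA : M.RepresentsA EA W) (hrB : M.RepresentsB EB W) (hbase : M.InBase EB W) (hlip : M.DataLipschitz W κ Λ ρ₀)
    (hdA : DecayBound EA W EA₀ κ) (hdB : DecayBound EB W E₀ κ) (hop : M.OperatorRate W δ θ)
    (hins : M.InsertionRate W κ E₀ δ' θ) (hdamp : M.InsertionDampedNat W κ c ω)
    (hcop : CouplingDataOp M W ℓop) (hcins : CouplingDataIns M W κ E₀ ℓins)
    (hread : ∀ K, TwoRunReadOutModel S r EA EB κ (g K) (g (K + 1)) K)
    (hrun : ∀ K, RGEqH K β (g K)) (hbox : ∀ K i, i ≤ K → 0 < g K i ∧ g K i ≤ γ) (hpin : ∀ K, g K K = gIR)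
    (hgA : ∀ K, g K ∈ W) (hgB : ∀ K, (fun i => g (K + 1) (i + 1)) ∈ W)
    (hWΓ : ∀ g₁ ∈ W, ∀ g₂ ∈ W, ∀ i, |g₁ i - g₂ i| ≤ Γ)
    (hconv : ∀ k, |S.β0 k - binf| ≤ c₀ * ρ ^ k)
    (hΛ : 0 ≤ Λ) (hδ : 0 ≤ δ + δ') (hθ : 0 ≤ θ) (hθρ : θ ≤ ρ) (hρ1 : ρ < 1) (hc : 0 ≤ c) (hω0 : 0 < ω)
    (hℓop : 0 ≤ ℓop) (hℓins : 0 ≤ ℓins) (hB : 0 ≤ B) (hc₀ : 0 ≤ c₀) (hr : 0 ≤ r)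
    (hnear : (δ + δ') * θ ^ k₀ + c * (EA₀ + E₀) / (1 - ω) + (ℓop + ℓins) * Γ ≤ ρ₀)
    (hfirst : ∀ k < k₀, EA₀ + E₀ ≤ B * θ ^ k)
    (hgap : ω + Λ * c < ρ)
    (hgain : r * (Λ * (ℓop + ℓins) * γ ^ 3) * ((ρ - ω) / (ρ - (ω + Λ * c))) ≤ (1 - ρ) / 2) :
    T4CauchySum.InjectedRate
      (2 * (2 * c₀ + r * ((Λ * (δ + δ') + B) + Λ * c * ((Λ * (δ + δ') + B) + Λ * (ℓop + ℓins) * Γ))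
        * ((ρ - ω) / (ρ - (ω + Λ * c)))) / (1 - ρ)) 0 ρ
      (fun K j => T4CouplingMatching.disc (g K) (g (K + 1)) j) := by
  have hωne : ω ≠ 0 := hω0.ne'
  have e1 : Λ * (c / ω) * ω = Λ * c := by
    rw [mul_assoc, div_mul_cancel₀ c hωne]
  have e2 : ω * (1 + Λ * (c / ω)) = ω + Λ * c := by
    rw [mul_add, mul_one, ← mul_assoc, mul_comm ω Λ, mul_assoc, mul_div_cancel₀ c hωne]
  have e3 : c / ω * (EA₀ + E₀) * (ω / (1 - ω)) = c * (EA₀ + E₀) / (1 - ω) := by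
    rw [← mul_div_assoc, div_mul_eq_mul_div, div_mul_cancel₀ _ hωne]
  have hnear' : (δ + δ') * θ ^ k₀ + c / ω * (EA₀ + E₀) * (ω / (1 - ω)) + (ℓop + ℓins) * Γ ≤ ρ₀ := by
    rw [e3]; exact hnear
  have hgap' : ω * (1 + Λ * (c / ω)) < ρ := by rw [e2]; exact hgap
  have hgain' : r * (Λ * (ℓop + ℓins) * γ ^ 3) * ((ρ - ω) / (ρ - ω * (1 + Λ * (c / ω)))) ≤ (1 - ρ) / 2 := by
    rw [e2]; exact hgain
  have key := injectedRate_of_stepModel₂ S g gIR M hrA hrB hbase hlip hdA hdB hop hins (M.insertionDamped_of_nat hdamp hω0)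
    hcop hcins hread hrun hbox hpin hgA hgB hWΓ hconv hΛ hδ hθ hθρ hρ1 (div_nonneg hc hω0.le) hω0 hℓop hℓins hB hc₀ hr
    hnear' hfirst hgap' hgain'
  rw [e1, e2] at key
  exact key

/-- **THE END WITH EVERY WALL IN ROW NE5's MOST PRIMITIVE TYPED FORM** (the letters of NE5's
`ne5_at_of_stepModel_fibre_scale_nat`): the two FIBRE envelopes `OpFibreEnvelope W κ G` ∧ `HistFibreEnvelope W κ G`
(G-ne5p1-1″) in place of `DataLipschitz` (Cauchy along fibres: `Λ = G/(1 − ρ₀)`, `ρ₀ < 1`, NE5's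
`dataLipschitz_of_fibreEnvelopes`), the structural insertion shapes `InsAffine ∧ InsBlind ∧ InsHomog` + the displayed
single-scale term `InsScaleBound W κ E₁ c ω` (G-ne5p1-3a″, `E₁ > 0`) in place of the damped insertion (NE5's
`insertionDampedNat_of_affine ∘ sizeDampedNat_of_scaleBound`), plus this route's two coupling-data shapes and the read-out
binder; gap `ω + Gc/(1 − ρ₀) < ρ`.  `injectedRate_of_stepModel₂_nat` ∘ NE5's conversions, nothing else. [folklore] -/
theorem injectedRate_of_stepModel₂_fibre {β : HBeta} (S : B12Beta.OneLoopSplit β) (g : ℕ → ℕ → ℝ) (gIR : ℝ)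
    (M : StepModel C Op Hist) {EA : Functional C C.BgA} {EB : Functional C C.BgB} {W : Set (ℕ → ℝ)}
    {κ G EA₀ E₀ E₁ δ δ' θ c ω ρ₀ B ℓop ℓins Γ γ binf c₀ r ρ : ℝ} {k₀ : ℕ}
    (hrA : M.RepresentsA EA W) (hrB : M.RepresentsB EB W) (hbase : M.InBase EB W)
    (hopF : M.OpFibreEnvelope W κ G) (hhistF : M.HistFibreEnvelope W κ G)
    (hdA : DecayBound EA W EA₀ κ) (hdB : DecayBound EB W E₀ κ) (hop : M.OperatorRate W δ θ)
    (hins : M.InsertionRate W κ E₀ δ' θ) (haff : M.InsAffine W) (hblind : M.InsBlind W) (hhom : M.InsHomog W)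
    (hunit : M.InsScaleBound W κ E₁ c ω)
    (hcop : CouplingDataOp M W ℓop) (hcins : CouplingDataIns M W κ E₀ ℓins)
    (hread : ∀ K, TwoRunReadOutModel S r EA EB κ (g K) (g (K + 1)) K)
    (hrun : ∀ K, RGEqH K β (g K)) (hbox : ∀ K i, i ≤ K → 0 < g K i ∧ g K i ≤ γ) (hpin : ∀ K, g K K = gIR)
    (hgA : ∀ K, g K ∈ W) (hgB : ∀ K, (fun i => g (K + 1) (i + 1)) ∈ W)
    (hWΓ : ∀ g₁ ∈ W, ∀ g₂ ∈ W, ∀ i, |g₁ i - g₂ i| ≤ Γ)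
    (hconv : ∀ k, |S.β0 k - binf| ≤ c₀ * ρ ^ k)
    (hE₁ : 0 < E₁) (hG : 0 ≤ G) (hρ₀ : ρ₀ < 1) (hδ : 0 ≤ δ + δ') (hθ : 0 ≤ θ) (hθρ : θ ≤ ρ) (hρ1 : ρ < 1)
    (hc : 0 ≤ c) (hω0 : 0 < ω) (hℓop : 0 ≤ ℓop) (hℓins : 0 ≤ ℓins) (hB : 0 ≤ B) (hc₀ : 0 ≤ c₀) (hr : 0 ≤ r)
    (hnear : (δ + δ') * θ ^ k₀ + c * (EA₀ + E₀) / (1 - ω) + (ℓop + ℓins) * Γ ≤ ρ₀)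
    (hfirst : ∀ k < k₀, EA₀ + E₀ ≤ B * θ ^ k)
    (hgap : ω + G / (1 - ρ₀) * c < ρ)
    (hgain : r * (G / (1 - ρ₀) * (ℓop + ℓins) * γ ^ 3) * ((ρ - ω) / (ρ - (ω + G / (1 - ρ₀) * c))) ≤ (1 - ρ) / 2) :
    T4CauchySum.InjectedRate
      (2 * (2 * c₀ + r * ((G / (1 - ρ₀) * (δ + δ') + B)
        + G / (1 - ρ₀) * c * ((G / (1 - ρ₀) * (δ + δ') + B) + G / (1 - ρ₀) * (ℓop + ℓins) * Γ))
        * ((ρ - ω) / (ρ - (ω + G / (1 - ρ₀) * c)))) / (1 - ρ)) 0 ρ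
      (fun K j => T4CouplingMatching.disc (g K) (g (K + 1)) j) :=
  injectedRate_of_stepModel₂_nat S g gIR M hrA hrB hbase (M.dataLipschitz_of_fibreEnvelopes hopF hhistF hρ₀) hdA hdB
    hop hins (M.insertionDampedNat_of_affine haff (M.sizeDampedNat_of_scaleBound haff hblind hhom hunit hE₁)) hcop hcins
    hread hrun hbox hpin hgA hgB hWΓ hconv (div_nonneg hG (by linarith)) hδ hθ hθρ hρ1 hc hω0 hℓop hℓins hB hc₀ hr hnear
    hfirst hgap hgain

end Currencies

end Summit.QuantumFields.BalabanUV.T4Continuum.NE4TwoRunStepModelEnd
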